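import Summits.BirchSwinnertonDyer.BirchSwinnertonDyer.Theorems.CyclotomicUntwistNineIntegersResidueMap
import HarnessLib

/-!
# The ring `𝓞 = integralClosure ℤ₃ ℚ₃(ζ₉)` of the LOCAL currency of `DescendedFrobeniusMatrix`, III: the reduction
# map is UNIQUE with kernel `(1 − ζ₉)𝓞` and `𝓞 ⧸ (1 − ζ₉) ≃ 𝔽₃`; `[ℚ₃(ζ₉) : ℚ₃] = 6`, so `Φ₉` is IRREDUCIBLE
# over `ℚ₃`; and `𝓞 = ℤ₃[ζ₉]`

Cell `pub/bsd-wall` (D-0145 line `route-BirchSwinnertonDyer-CyclotomicUntwist`), seat `bsd-line-cycu-p4` (gen 7),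
helper toward K1 `PSRankOneLowerHalfAtThree` (stmt-BirchSwinnertonDyer-21580) / K2 (21581); line `dfrob`, stub S2
`stub_descendedFrobenius` = item C2 `PSDescendedFrobeniusPrintedInputsAtThree` (stmt-27549) of the K-SEP split.
Sequel of `CyclotomicUntwistNineIntegers.lean` / `…ResidueMap.lean`. THEOREMS ONLY (no definition, no named fact,
no `sorry`); BSD is not proved by this file and no crux is.

## What and why

The Literature definition file `DescendedFrobeniusMatrix.lean` (p623342) works over `K = KNine = CyclotomicField 9 ℚ_[3]`
and `𝓞 = ONine = integralClosure ℤ_[3] K` and SAYS in its docstrings (without proof) that `𝓞` is local with residue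
field `𝔽₃`, that a reduction map `ρ : 𝓞 →+* ZMod 3` "is unique" and that `𝓞` is "the valuation ring". The prequel
proved `𝓞/(1 − ζ₉)𝓞 = 𝔽₃` elementwise and `Nonempty (ONine →+* ZMod 3)` (consumed by cycu-p3's closer
`stub_descendedFrobenius_of_exists'`, p-11:17Z). This file turns the remaining docstring claims into theorems, so
that "the special fibre `𝓜.specialFibre ρ`" of a good model is ONE curve over `𝔽₃` (not a `ρ`-indexed family) and the
local field data of the route's untwist (`e = 6`, `f = 1`, `𝓞 = ℤ₃[ζ₉]`) are kernel facts:

* §6 **uniqueness**: `residueMap_unique` / `subsingleton_residueMap` (every `ρ` reads the residue digit),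
  `residueMap_surjective`, **`residueMap_eq_zero_iff`** (`ρ x = 0 ↔ x ∈ (1 − ζ₉)𝓞`), `ker_residueMap_eq`
  (`ker ρ = 𝓞·(1 − ζ₉)`), **`nonempty_quotient_equiv_zmod`** (`𝓞 ⧸ (1 − ζ₉) ≃+* ZMod 3`: `f = 1`);
* §7 **`e = 6`**: `norm_lt_one_of_relation_pow` (a `ℤ₃`-relation among `1, (1−ζ₉), …, (1−ζ₉)⁵` has all
  coefficients in `3ℤ₃`), `linearIndependent_one_sub_zeta_pow`, **`finrank_eq_six : [ℚ₃(ζ₉) : ℚ₃] = 6`**,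
  `minpoly_zeta_eq_cyclotomic`, **`irreducible_cyclotomic_nine_padic : Irreducible (cyclotomic 9 ℚ_[3])`** — the
  `3`-adic counterpart of `Polynomial.cyclotomic.irreducible_rat`, which Mathlib does not have;
* §8 **`integralClosure_eq_adjoin : ONine = Algebra.adjoin ℤ_[3] {ζ₉}`** (`𝓞 = ℤ₃[ζ₉]`): digit expansion to order
  `6` gives `𝓞 = ℤ₃[ζ₉] + 3𝓞`; `𝓞` is a finitely generated `ℤ₃`-module (`IsIntegralClosure.finite`, separability in
  characteristic `0`); `3` lies in the Jacobson radical of the local ring `ℤ₃`; Nakayama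
  (`Submodule.le_of_le_smul_of_le_jacobson_bot`). The local counterpart of Mathlib's
  `IsCyclotomicExtension.Rat.isIntegralClosure_adjoin_singleton_of_prime_pow`; `exists_aeval_eq_of_mem` spells it
  elementwise.

References: J.-P. Serre, *Local Fields*, GTM 67, I §6 Prop. 17–18 (totally ramified extensions, `𝓞_L = 𝓞_K[π]`)
[SerreLocalFields1979]; L. C. Washington, *Introduction to Cyclotomic Fields*, GTM 83, Lemma 1.4, Prop. 2.8, Thm. 2.6
[Washington1997]; F. Q. Gouvêa, *p-adic Numbers*, §5 [Gouvea1993PadicNumbers].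
-/

noncomputable section

open scoped Polynomial

open Polynomial IsCyclotomicExtension Literature.NumberTheory.EllipticCurves.DescendedFrobenius
  Summit.BirchSwinnertonDyer.BirchSwinnertonDyer.Theorems Summit.BirchSwinnertonDyer.Rank1Residual.O5

-- single-conjunct summit: `Summit.BirchSwinnertonDyer.BirchSwinnertonDyer.…` repeats the name by design
set_option linter.dupNamespace false
set_option autoImplicit false

namespace Summit.BirchSwinnertonDyer.BirchSwinnertonDyer.Theorems.NineIntegers

/-! ### §6 The reduction map is unique, surjective, with kernel `(1 − ζ₉)𝓞` -/

/-- **Every reduction map is the digit map**: `ρ x = a` for the residue digit `a` of `x` (`exists_int_sub_eq_mul`).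
[folklore] -/
theorem exists_int_residueMap_eq (ρ : ONine →+* ZMod 3) (x : ONine) :
    ∃ (a : ℤ) (y : KNine), y ∈ ONine ∧ (x : KNine) - a = (1 - zeta 9 ℚ_[3] KNine) * y ∧ ρ x = a := by
  obtain ⟨a, y, hy, h⟩ := exists_int_sub_eq_mul x.1 x.2
  exact ⟨a, y, hy, h, residueMap_eq_of_sub_eq_mul ρ hy h⟩

/-- **UNIQUENESS of the reduction map `𝓞 →+* 𝔽₃`** (both read the residue digit). [folklore] -/
theorem residueMap_unique (ρ ρ' : ONine →+* ZMod 3) : ρ = ρ' := by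
  refine RingHom.ext fun x => ?_
  obtain ⟨a, y, hy, h, hρ⟩ := exists_int_residueMap_eq ρ x
  rw [hρ, residueMap_eq_of_sub_eq_mul ρ' hy h]

/-- `ONine →+* ZMod 3` is a subsingleton (and nonempty: `nonempty_residueMap`), i.e. THE reduction map exists.
[folklore] -/
theorem subsingleton_residueMap : Subsingleton (ONine →+* ZMod 3) := ⟨residueMap_unique⟩

/-- Every reduction map is surjective (`ρ n = n`). [folklore] -/
theorem residueMap_surjective (ρ : ONine →+* ZMod 3) : Function.Surjective ρ := by
  intro t
  refine ⟨((t.val : ℤ) : ONine), ?_⟩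
  rw [map_intCast]
  simp

/-- **The kernel of a reduction map is `(1 − ζ₉)𝓞`**: `ρ x = 0 ↔ x ∈ (1 − ζ₉)·𝓞`. [folklore] -/
theorem residueMap_eq_zero_iff (ρ : ONine →+* ZMod 3) (x : ONine) :
    ρ x = 0 ↔ ∃ y : KNine, y ∈ ONine ∧ (x : KNine) = (1 - zeta 9 ℚ_[3] KNine) * y := by
  set ζ := zeta 9 ℚ_[3] KNine with hζdef
  constructor
  · intro h0
    obtain ⟨a, y, hy, h, hρ⟩ := exists_int_residueMap_eq ρ x
    rw [h0, eq_comm, ZMod.intCast_zmod_eq_zero_iff_dvd] at hρ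
    obtain ⟨k, rfl⟩ := hρ
    have h3 := three_eq_neg_pow_six_mul_thetaInv zeta_spec
    rw [← hζdef] at h3
    refine ⟨y - (1 - ζ) ^ 5 * (-10 - 11 * ζ - 7 * ζ ^ 2 - 10 * ζ ^ 3 - 4 * ζ ^ 4 + 4 * ζ ^ 5) * k,
      sub_mem hy (mul_mem (mul_mem (pow_mem one_sub_zeta_mem 5) thetaInv_mem) (intCast_mem ONine k)), ?_⟩
    have h' : (x : KNine) = ((3 * k : ℤ) : KNine) + (1 - ζ) * y := by rw [← h]; ring
    rw [h']
    push_cast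
    linear_combination (k : KNine) * h3
  · rintro ⟨y, hy, h⟩
    have e : x = ⟨1 - zeta 9 ℚ_[3] KNine, one_sub_zeta_mem⟩ * ⟨y, hy⟩ := Subtype.ext (by push_cast; exact h)
    rw [e, map_mul, residueMap_one_sub_zeta, zero_mul]

/-- The kernel as an ideal: `ker ρ = 𝓞·(1 − ζ₉)`. [folklore] -/
theorem ker_residueMap_eq (ρ : ONine →+* ZMod 3) :
    RingHom.ker ρ = Ideal.span {(⟨1 - zeta 9 ℚ_[3] KNine, one_sub_zeta_mem⟩ : ONine)} := by
  ext x
  rw [RingHom.mem_ker, residueMap_eq_zero_iff, Ideal.mem_span_singleton']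
  constructor
  · rintro ⟨y, hy, h⟩
    exact ⟨⟨y, hy⟩, Subtype.ext (by push_cast; rw [h, mul_comm])⟩
  · rintro ⟨y, hy⟩
    exact ⟨y, y.2, by rw [← hy]; push_cast; ring⟩

/-- `3 ∈ ker ρ` (indeed `3 = −(1 − ζ₉)⁶θ⁻¹`): every reduction map factors through `𝓞/3𝓞`. [folklore] -/
theorem residueMap_three (ρ : ONine →+* ZMod 3) : ρ 3 = 0 := by
  rw [map_ofNat]; decide

/-- **`𝓞 ⧸ (1 − ζ₉) ≃+* 𝔽₃`**: the residue field of `𝓞 = integralClosure ℤ₃ ℚ₃(ζ₉)` along the uniformizer is the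
field with three elements (`f = 1`). [folklore] -/
theorem nonempty_quotient_equiv_zmod :
    Nonempty ((ONine ⧸ Ideal.span {(⟨1 - zeta 9 ℚ_[3] KNine, one_sub_zeta_mem⟩ : ONine)}) ≃+* ZMod 3) := by
  obtain ⟨ρ⟩ := nonempty_residueMap
  rw [← ker_residueMap_eq ρ]
  exact ⟨RingHom.quotientKerEquivOfSurjective (residueMap_surjective ρ)⟩

/-! ### §7 The powers of the uniformizer are independent: `[ℚ₃(ζ₉) : ℚ₃] = 6`, `Φ₉` irreducible over `ℚ₃` -/

/-- **Peeling, digit-free form**: a relation `Σ_{j<6} cⱼ (1 − ζ₉)ʲ = 0` with `cⱼ ∈ ℤ₃` forces every `cⱼ ∈ 3ℤ₃`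
(`e ≥ 6`). [folklore] -/
theorem norm_lt_one_of_relation_pow (c : ℕ → ℚ_[3]) (hc : ∀ j, ‖c j‖ ≤ 1)
    (hrel : ∑ j ∈ Finset.range 6, algebraMap ℚ_[3] KNine (c j) * (1 - zeta 9 ℚ_[3] KNine) ^ j = 0) :
    ∀ j < 6, ‖c j‖ < 1 := by
  set ζ := zeta 9 ℚ_[3] KNine with hζdef
  set φ := algebraMap ℚ_[3] KNine with hφ
  have h3 := three_eq_neg_pow_six_mul_thetaInv zeta_spec
  rw [← hζdef] at h3
  have h3φ : φ 3 = 3 := map_ofNat φ 3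
  have hπ0 : (1 - ζ) ≠ 0 := GNine.one_sub_zeta_ne_zero zeta_spec
  have key : ∀ k ≤ 6, ∀ j < k, ‖c j‖ < 1 := by
    intro k
    induction k with
    | zero => intro _ j hj; exact absurd hj (Nat.not_lt_zero j)
    | succ k IH =>
      intro hk j hj
      have IH' := IH (by omega)
      rcases Nat.lt_succ_iff_lt_or_eq.mp hj with hjk | rfl
      · exact IH' j hjk
      · have hj6 : j < 6 := by omega
        have hlow : ∑ i ∈ Finset.range j, φ (c i) * (1 - ζ) ^ i =
            3 * ∑ i ∈ Finset.range j, φ (c i / 3) * (1 - ζ) ^ i := by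
          rw [Finset.mul_sum]
          refine Finset.sum_congr rfl fun i hi => ?_
          have e0 : φ (c i) = 3 * φ (c i / 3) := by rw [← h3φ, ← map_mul]; congr 1; ring
          rw [e0]; ring
        have hA : ∑ i ∈ Finset.range j, φ (c i / 3) * (1 - ζ) ^ i ∈ ONine := by
          refine sum_mem fun i hi => ?_
          have hij : i < j := Finset.mem_range.mp hi
          exact mul_mem (algebraMap_mem_of_norm_le_one (FlexTangent.norm_div_three_le_one (IH' i hij)))
            (pow_mem one_sub_zeta_mem i)
        have hup : ∑ i ∈ Finset.Ico (j + 1) 6, φ (c i) * (1 - ζ) ^ i =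
            (1 - ζ) ^ (j + 1) * ∑ i ∈ Finset.Ico (j + 1) 6, φ (c i) * (1 - ζ) ^ (i - (j + 1)) := by
          rw [Finset.mul_sum]
          refine Finset.sum_congr rfl fun i hi => ?_
          have hle : j + 1 ≤ i := (Finset.mem_Ico.mp hi).1
          rw [show (1 - ζ) ^ i = (1 - ζ) ^ (j + 1) * (1 - ζ) ^ (i - (j + 1)) by
            rw [← pow_add, Nat.add_sub_cancel' hle]]
          ring
        have hB : ∑ i ∈ Finset.Ico (j + 1) 6, φ (c i) * (1 - ζ) ^ (i - (j + 1)) ∈ ONine :=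
          sum_mem fun i _ => mul_mem (algebraMap_mem_of_norm_le_one (hc i)) (pow_mem one_sub_zeta_mem _)
        have hsplit := hrel
        rw [← Finset.sum_range_add_sum_Ico _ hj6.le, Finset.sum_eq_sum_Ico_succ_bot hj6, hlow, hup]
          at hsplit
        have e6 : (1 - ζ) ^ 6 = (1 - ζ) ^ (j + 1) * (1 - ζ) ^ (5 - j) := by
          rw [← pow_add]; congr 1; omega
        set A := ∑ i ∈ Finset.range j, φ (c i / 3) * (1 - ζ) ^ i with hAdef
        set B := ∑ i ∈ Finset.Ico (j + 1) 6, φ (c i) * (1 - ζ) ^ (i - (j + 1)) with hBdef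
        set θi := (-10 - 11 * ζ - 7 * ζ ^ 2 - 10 * ζ ^ 3 - 4 * ζ ^ 4 + 4 * ζ ^ 5) with hθi
        have hW : φ (c j) * (1 - ζ) ^ j = ((1 - ζ) * ((1 - ζ) ^ (5 - j) * θi * A - B)) * (1 - ζ) ^ j := by
          have e : φ (c j) * (1 - ζ) ^ j = -(3 * A) - (1 - ζ) ^ (j + 1) * B := by
            linear_combination hsplit
          rw [e, h3, e6]; ring
        have ht_eq : φ (c j) = (1 - ζ) * ((1 - ζ) ^ (5 - j) * θi * A - B) :=
          mul_right_cancel₀ (pow_ne_zero j hπ0) hW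
        have hY : (1 - ζ) ^ (5 - j) * θi * A - B ∈ ONine :=
          sub_mem (mul_mem (mul_mem (pow_mem one_sub_zeta_mem _) thetaInv_mem) hA) hB
        -- if `‖c j‖ = 1` then `1 − ζ` would be a unit of `𝓞`
        by_contra hcj
        have hn : ‖c j‖ = 1 := le_antisymm (hc j) (not_lt.mp hcj)
        have hc0 : c j ≠ 0 := by
          intro h0; rw [h0, norm_zero] at hn; exact zero_ne_one hn
        have hinv : ‖(c j)⁻¹‖ ≤ 1 := by rw [norm_inv, hn, inv_one]
        apply one_sub_zeta_mul_ne_one (mul_mem hY (algebraMap_mem_of_norm_le_one hinv))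
        rw [← hζdef, ← mul_assoc, ← ht_eq, ← map_mul, mul_inv_cancel₀ hc0, map_one]
  exact key 6 le_rfl

/-- **`1, (1 − ζ₉), …, (1 − ζ₉)⁵` are `ℚ₃`-linearly independent** (`e(ℚ₃(ζ₉)/ℚ₃) ≥ 6`). [folklore] -/
theorem linearIndependent_one_sub_zeta_pow :
    LinearIndependent ℚ_[3] (fun j : Fin 6 => (1 - zeta 9 ℚ_[3] KNine) ^ (j : ℕ)) := by
  rw [Fintype.linearIndependent_iff]
  intro g hsum
  by_contra hne
  push Not at hne
  obtain ⟨i₀, hi₀⟩ := hne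
  obtain ⟨m, -, hm⟩ := Finset.exists_max_image Finset.univ (fun i => ‖g i‖) Finset.univ_nonempty
  have hgm : g m ≠ 0 := by
    intro h0
    apply hi₀
    have := hm i₀ (Finset.mem_univ _)
    rw [h0, norm_zero] at this
    exact norm_le_zero_iff.mp this
  let c : ℕ → ℚ_[3] := fun j => if h : j < 6 then g ⟨j, h⟩ / g m else 0
  have hc : ∀ j, ‖c j‖ ≤ 1 := by
    intro j; by_cases h : j < 6
    · simp only [c, dif_pos h, norm_div]
      exact div_le_one_of_le₀ (hm _ (Finset.mem_univ _)) (norm_nonneg _)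
    · simp only [c, dif_neg h, norm_zero]; exact zero_le_one
  have hrel : ∑ j ∈ Finset.range 6, algebraMap ℚ_[3] KNine (c j) * (1 - zeta 9 ℚ_[3] KNine) ^ j = 0 := by
    have h1 : ∑ i : Fin 6, (g i / g m) • (1 - zeta 9 ℚ_[3] KNine) ^ (i : ℕ) = 0 := by
      have := congrArg (fun z => (g m)⁻¹ • z) hsum
      simp only [Finset.smul_sum, smul_smul, smul_zero] at this
      rw [← this]
      refine Finset.sum_congr rfl fun p _ => ?_
      rw [div_eq_inv_mul]
    rw [← Fin.sum_univ_eq_sum_range (fun j => algebraMap ℚ_[3] KNine (c j) * (1 - zeta 9 ℚ_[3] KNine) ^ j) 6,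
      ← h1]
    refine Finset.sum_congr rfl fun j _ => ?_
    simp only [c, dif_pos j.2, Fin.eta, Algebra.smul_def]
  have hall := norm_lt_one_of_relation_pow c hc hrel m m.2
  simp only [c, dif_pos m.2, Fin.eta, div_self hgm, norm_one] at hall
  exact lt_irrefl _ hall

/-- **`[ℚ₃(ζ₉) : ℚ₃] = 6`** (`≥ 6` by `linearIndependent_one_sub_zeta_pow`, `≤ 6` since `ζ₉` is a root of `Φ₉`).
[folklore] -/
theorem finrank_eq_six : Module.finrank ℚ_[3] KNine = 6 := by
  haveI : Module.Finite ℚ_[3] KNine := IsCyclotomicExtension.finite {9} ℚ_[3] KNine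
  have hζ := zeta_spec
  refine le_antisymm ?_ ?_
  · rw [(IsPrimitiveRoot.powerBasis ℚ_[3] hζ).finrank, IsPrimitiveRoot.powerBasis_dim]
    have hdvd : minpoly ℚ_[3] (zeta 9 ℚ_[3] KNine) ∣ cyclotomic 9 ℚ_[3] :=
      minpoly.dvd ℚ_[3] _ (by
        rw [aeval_def, ← eval_map, map_cyclotomic, ← IsRoot.def, isRoot_cyclotomic_iff]
        exact hζ)
    calc (minpoly ℚ_[3] (zeta 9 ℚ_[3] KNine)).natDegree ≤ (cyclotomic 9 ℚ_[3]).natDegree :=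
          natDegree_le_of_dvd hdvd (cyclotomic_ne_zero 9 ℚ_[3])
      _ = 6 := by rw [natDegree_cyclotomic]; decide
  · simpa using linearIndependent_one_sub_zeta_pow.fintype_card_le_finrank

/-- `ζ₉` is integral over `ℚ₃`. [folklore] -/
theorem zeta_isIntegral_padic : IsIntegral ℚ_[3] (zeta 9 ℚ_[3] KNine) := zeta_isIntegral.tower_top

/-- The minimal polynomial of `ζ₉` over `ℚ₃` is `Φ₉`. [folklore] -/
theorem minpoly_zeta_eq_cyclotomic : minpoly ℚ_[3] (zeta 9 ℚ_[3] KNine) = cyclotomic 9 ℚ_[3] := by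
  haveI : Module.Finite ℚ_[3] KNine := IsCyclotomicExtension.finite {9} ℚ_[3] KNine
  have hζ := zeta_spec
  have hdvd : minpoly ℚ_[3] (zeta 9 ℚ_[3] KNine) ∣ cyclotomic 9 ℚ_[3] :=
    minpoly.dvd ℚ_[3] _ (by
      rw [aeval_def, ← eval_map, map_cyclotomic, ← IsRoot.def, isRoot_cyclotomic_iff]
      exact hζ)
  have hdeg : (minpoly ℚ_[3] (zeta 9 ℚ_[3] KNine)).natDegree = 6 := by
    have h := finrank_eq_six
    rw [(IsPrimitiveRoot.powerBasis ℚ_[3] hζ).finrank, IsPrimitiveRoot.powerBasis_dim] at h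
    exact h
  symm
  refine eq_of_monic_of_dvd_of_natDegree_le (minpoly.monic zeta_isIntegral_padic) (cyclotomic.monic 9 ℚ_[3])
    hdvd ?_
  rw [hdeg, natDegree_cyclotomic]; decide

/-- **`Φ₉` is irreducible over `ℚ₃`** (the local counterpart of `cyclotomic.irreducible_rat`, absent from Mathlib:
`3` is totally ramified in `ℚ₃(ζ₉)`). [folklore] -/
theorem irreducible_cyclotomic_nine_padic : Irreducible (cyclotomic 9 ℚ_[3]) := by
  rw [← minpoly_zeta_eq_cyclotomic]
  exact minpoly.irreducible zeta_isIntegral_padic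

/-! ### §8 `𝓞 = ℤ₃[ζ₉]`: the integral closure is generated by `ζ₉` (Nakayama) -/

/-- `ℤ₃[ζ₉] ⊆ 𝓞`. [folklore] -/
theorem adjoin_zeta_le : Algebra.adjoin ℤ_[3] {zeta 9 ℚ_[3] KNine} ≤ ONine :=
  Algebra.adjoin_le (Set.singleton_subset_iff.mpr zeta_mem)

/-- `1 − ζ₉ ∈ ℤ₃[ζ₉]`. [folklore] -/
theorem one_sub_zeta_mem_adjoin : 1 - zeta 9 ℚ_[3] KNine ∈ Algebra.adjoin ℤ_[3] {zeta 9 ℚ_[3] KNine} :=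
  sub_mem (one_mem _) (Algebra.subset_adjoin (Set.mem_singleton _))

/-- **Digit expansion to any order**: `x ∈ 𝓞` is `≡` an element of `ℤ₃[ζ₉]` modulo `(1 − ζ₉)ᵏ𝓞`, for every `k`
(iterate `exists_int_sub_eq_mul`). [folklore] -/
theorem exists_mem_adjoin_add_pow_mul (x : KNine) (hx : x ∈ ONine) (k : ℕ) :
    ∃ p ∈ Algebra.adjoin ℤ_[3] {zeta 9 ℚ_[3] KNine}, ∃ y ∈ ONine,
      x = p + (1 - zeta 9 ℚ_[3] KNine) ^ k * y := by
  induction k with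
  | zero => exact ⟨0, zero_mem _, x, hx, by ring⟩
  | succ k IH =>
    obtain ⟨p, hp, y, hy, hxy⟩ := IH
    obtain ⟨a, y', hy', hay⟩ := exists_int_sub_eq_mul y hy
    refine ⟨p + (a : KNine) * (1 - zeta 9 ℚ_[3] KNine) ^ k,
      add_mem hp (mul_mem (intCast_mem _ a) (pow_mem one_sub_zeta_mem_adjoin k)), y', hy', ?_⟩
    have ey : y = (a : KNine) + (1 - zeta 9 ℚ_[3] KNine) * y' := by linear_combination hay
    rw [hxy, ey]; ring

/-- **Digit expansion modulo `3`**: every `x ∈ 𝓞` is `p + 3y` with `p ∈ ℤ₃[ζ₉]`, `y ∈ 𝓞` (order `6`, and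
`(1 − ζ₉)⁶ = −3θ`). [folklore] -/
theorem exists_mem_adjoin_add_three_mul (x : KNine) (hx : x ∈ ONine) :
    ∃ p ∈ Algebra.adjoin ℤ_[3] {zeta 9 ℚ_[3] KNine}, ∃ y ∈ ONine, x = p + 3 * y := by
  obtain ⟨p, hp, y, hy, hxy⟩ := exists_mem_adjoin_add_pow_mul x hx 6
  have h6 := GNine.varpi_pow_six zeta_spec
  refine ⟨p, hp, -(1 - 3 * (1 - zeta 9 ℚ_[3] KNine) + 6 * (1 - zeta 9 ℚ_[3] KNine) ^ 2
      - 7 * (1 - zeta 9 ℚ_[3] KNine) ^ 3 + 5 * (1 - zeta 9 ℚ_[3] KNine) ^ 4 - 2 * (1 - zeta 9 ℚ_[3] KNine) ^ 5) * y,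
    mul_mem (neg_mem theta_mem) hy, ?_⟩
  rw [hxy]
  linear_combination y * h6

/-- `𝓞` is a finitely generated `ℤ₃`-module (integral closure of a Noetherian integrally closed domain in a finite
separable extension). [folklore] -/
theorem toSubmodule_fg : (Subalgebra.toSubmodule ONine).FG := by
  haveI : Module.Finite ℚ_[3] KNine := IsCyclotomicExtension.finite {9} ℚ_[3] KNine
  haveI : Module.Finite ℤ_[3] ONine := IsIntegralClosure.finite ℤ_[3] ℚ_[3] KNine ONine
  exact (Submodule.fg_top _).mp Module.Finite.fg_top

/-- **`𝓞 = ℤ₃[ζ₉]`: the integral closure of `ℤ₃` in `ℚ₃(ζ₉)` is generated by `ζ₉`** (`𝓞 = ℤ₃[ζ₉] + 3𝓞` by the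
digit expansion, `𝓞` finitely generated, `3` in the Jacobson radical of the local ring `ℤ₃`: Nakayama). The local
counterpart of Mathlib's `IsCyclotomicExtension.Rat.isIntegralClosure_adjoin_singleton_of_prime_pow`.
[folklore] -/
theorem integralClosure_eq_adjoin : ONine = Algebra.adjoin ℤ_[3] {zeta 9 ℚ_[3] KNine} := by
  refine le_antisymm ?_ adjoin_zeta_le
  have key : Subalgebra.toSubmodule ONine ≤ Subalgebra.toSubmodule (Algebra.adjoin ℤ_[3] {zeta 9 ℚ_[3] KNine}) := by
    refine Submodule.le_of_le_smul_of_le_jacobson_bot (I := IsLocalRing.maximalIdeal ℤ_[3]) toSubmodule_fg ?_ ?_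
    · rw [IsLocalRing.jacobson_eq_maximalIdeal ⊥ bot_ne_top]
    · intro x hx
      obtain ⟨p, hp, y, hy, hxy⟩ := exists_mem_adjoin_add_three_mul x hx
      rw [hxy]
      refine Submodule.add_mem_sup (show p ∈ Subalgebra.toSubmodule _ from hp) ?_
      have e3 : (3 : KNine) * y = (3 : ℤ_[3]) • y := by
        rw [Algebra.smul_def, IsScalarTower.algebraMap_apply ℤ_[3] ℚ_[3] KNine, map_ofNat, map_ofNat]
      rw [e3]
      refine Submodule.smul_mem_smul ?_ (show y ∈ Subalgebra.toSubmodule _ from hy)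
      rw [PadicInt.maximalIdeal_eq_span_p]
      exact Ideal.mem_span_singleton_self _
  intro x hx
  exact key (show x ∈ Subalgebra.toSubmodule _ from hx)

/-- Hence every element of `𝓞` is a `ℤ₃`-polynomial in `ζ₉`. [folklore] -/
theorem exists_aeval_eq_of_mem {x : KNine} (hx : x ∈ ONine) :
    ∃ p : ℤ_[3][X], x = aeval (zeta 9 ℚ_[3] KNine) p := by
  have hx' : x ∈ Algebra.adjoin ℤ_[3] {zeta 9 ℚ_[3] KNine} := by rw [← integralClosure_eq_adjoin]; exact hx
  rw [Algebra.adjoin_singleton_eq_range_aeval] at hx'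
  obtain ⟨p, hp⟩ := hx'
  exact ⟨p, hp.symm⟩

end Summit.BirchSwinnertonDyer.BirchSwinnertonDyer.Theorems.NineIntegers

end
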